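import Literature.NumberTheory.Automorphic.JacquetModule                       -- ★ `IsLimitOfCompactOpen`
import Literature.NumberTheory.Automorphic.HaarConjCompact                     -- ★ `modularCharacter_eq_one_of_mem_isCompact`
import Literature.NumberTheory.Automorphic.GLnAdelicIntegrationFactsProofs     -- ★ `isMulRightInvariant_of_modularCharacterFun_eq_one`
import Literature.NumberTheory.Automorphic.UnitaryGroupUnipotentLimitCompactOpen -- ★ `isLimitOfCompactOpen_cmBorelTriple_N`
import HarnessLib

/-!
# A group that is the limit of its compact open subgroups is unimodular
# (Bernstein–Zelevinsky 1976, §1.7; Folland 1995, §2.4; Knapp 2002, VIII §2)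

Topic `NumberTheory/Automorphic`; namespace `Literature.NumberTheory.Automorphic` (home of ★ `IsLimitOfCompactOpen`, file `JacquetModule`).
KERNEL ONLY: theorems, 0 definitions, 0 named facts, 0 `sorry`.  Cell `hodgecm-mathlib`, floor 0, programme P3, typer topic T3 (statement tree
`T3b-TREE.md` of ★ `KeysCaseTwo`, root N1 ★ `UnitaryGroup.U3PrincipalSeriesJacquetFiltration`): the LOWER-BOUND half of N1 («`ℓ ≠ 0`») is the
Haar functional `Λ(f) = ∫_N f(w₀ n) dn` on the open-cell sections, and `Λ(n₀ · f) = Λ(f)` needs the RIGHT invariance of the (left) Haar measure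
`dn` of the unipotent radical `N` — i.e. that `N` is unimodular.  Seat F0P3-p01 (g9).

THE MATHEMATICS.  If every compact subset of the locally compact group `H` lies in a compact open subgroup (★ `IsLimitOfCompactOpen H`;
[BernsteinZelevinsky1976, §1.7]: unipotent radicals of parabolics of reductive `p`-adic groups), then every `g ∈ H` lies in a compact subgroup,
on which the modular character — a continuous homomorphism to `ℝ_{>0}` with bounded image — is trivial (★ `modularCharacter_eq_one_of_mem_isCompact`;
[Folland1995, §2.4]; [Knapp2002, VIII §2]); so `Δ_H = 1` and every Haar measure on `H` is right invariant
(★ `isMulRightInvariant_of_modularCharacterFun_eq_one`).  The CM instance: the unipotent radical `(cmBorelTriple L N v).N` of the Borel of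
`U(Φ_N)(L⁺_v)` (★ `UnitaryGroup.isLimitOfCompactOpen_cmBorelTriple_N`), over whatever Borel structure the consumer fixes.

## References
* I. N. Bernstein, A. V. Zelevinsky, *Representations of the group GL(n, F) where F is a non-archimedean local field*, Russian Math. Surveys 31
  (1976), §1.7 [BernsteinZelevinsky1976].
* G. B. Folland, *A Course in Abstract Harmonic Analysis* (1995), §2.4 (the modular function; compact groups are unimodular) [Folland1995].
* A. W. Knapp, *Lie Groups Beyond an Introduction*, 2nd ed. (2002), VIII §2 [Knapp2002].
* W. Casselman, *Introduction to the theory of admissible representations of p-adic reductive groups* (1995), Prop. 1.4.4 ff. [Casselman1995].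
-/

set_option autoImplicit false

noncomputable section

open MeasureTheory Measure NumberField IsDedekindDomain

namespace Literature.NumberTheory.Automorphic

section Generic

variable {H : Type*} [Group H] [TopologicalSpace H]

/-- In a group that is the limit of its compact open subgroups, every element lies in a compact open subgroup (the definition applied to the
compact set `{g}`). [cite: BernsteinZelevinsky1976, §1.7] -/
theorem IsLimitOfCompactOpen.exists_mem_subgroup (h : IsLimitOfCompactOpen H) (g : H) :
    ∃ K : Subgroup H, IsOpen (K : Set H) ∧ IsCompact (K : Set H) ∧ g ∈ K := by
  obtain ⟨K, hKo, hKc, hK⟩ := h {g} isCompact_singleton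
  exact ⟨K, hKo, hKc, hK (Set.mem_singleton g)⟩

variable [IsTopologicalGroup H] [LocallyCompactSpace H]

/-- **`Δ_H = 1` on a limit of compact open subgroups**: the modular character of `H` is trivial (it is trivial on every compact subgroup, and
every element lies in one). [cite: BernsteinZelevinsky1976, §1.7] [cite: Folland1995, §2.4] -/
theorem IsLimitOfCompactOpen.modularCharacter_eq_one (h : IsLimitOfCompactOpen H) (g : H) : modularCharacter g = 1 := by
  obtain ⟨K, -, hKc, hg⟩ := h.exists_mem_subgroup g
  borelize H
  exact modularCharacter_eq_one_of_mem_isCompact hKc hg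

variable [MeasurableSpace H] [BorelSpace H] [SecondCountableTopology H]

/-- **A limit of compact open subgroups is unimodular**: every Haar measure on it is right invariant. [cite: BernsteinZelevinsky1976, §1.7]
[cite: Folland1995, §2.4] -/
theorem IsLimitOfCompactOpen.isMulRightInvariant (h : IsLimitOfCompactOpen H) (ν : Measure H) [ν.IsHaarMeasure] : ν.IsMulRightInvariant :=
  isMulRightInvariant_of_modularCharacterFun_eq_one (fun g => h.modularCharacter_eq_one g) ν

/-- **Right translation invariance of Haar integrals on a limit of compact open subgroups**: `∫ f(x g) dν(x) = ∫ f dν` — the invariance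
`Λ(n₀ · f) = Λ(f)` of the open-cell functional `Λ(f) = ∫_N f(w₀ n) dn` under the right regular action of `N`. [cite: BernsteinZelevinsky1976, §1.7]
[cite: Casselman1995, proof of Prop. 6.2.1] -/
theorem IsLimitOfCompactOpen.integral_mul_right_eq_self (h : IsLimitOfCompactOpen H) (ν : Measure H) [ν.IsHaarMeasure]
    {E : Type*} [NormedAddCommGroup E] [NormedSpace ℝ E] (f : H → E) (g : H) :
    ∫ x, f (x * g) ∂ν = ∫ x, f x ∂ν := by
  haveI := h.isMulRightInvariant ν
  exact MeasureTheory.integral_mul_right_eq_self f g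

end Generic

/-! ## The CM instance: the unipotent radical of the Borel of `U(Φ_N)(L⁺_v)` -/

section CM

open Literature.NumberTheory.Automorphic.UnitaryGroup

variable (L : Type) [Field L] [NumberField L] [IsCMField L] (N : ℕ) (v : HeightOneSpectrum (𝓞 ↥(maximalRealSubfield L)))

/-- **`N(L⁺_v)` is unimodular**: every Haar measure on the unipotent radical `(cmBorelTriple L N v).N` of the Borel of `U(Φ_N)(L⁺_v)` is right
invariant (★ `isLimitOfCompactOpen_cmBorelTriple_N` + the generic lemma), for any locally compact second countable group topology data and Borel
structure the consumer supplies on the subgroup type. [cite: BernsteinZelevinsky1976, §1.7] [cite: Casselman1995, proof of Prop. 6.2.1] -/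
theorem isMulRightInvariant_cmBorelTriple_N [LocallyCompactSpace ↥(cmBorelTriple L N v).N] [SecondCountableTopology ↥(cmBorelTriple L N v).N]
    [MeasurableSpace ↥(cmBorelTriple L N v).N] [BorelSpace ↥(cmBorelTriple L N v).N]
    (ν : Measure ↥(cmBorelTriple L N v).N) [ν.IsHaarMeasure] : ν.IsMulRightInvariant :=
  (isLimitOfCompactOpen_cmBorelTriple_N L N v).isMulRightInvariant ν

/-- **`∫_N f(n n₀) dn = ∫_N f(n) dn` on `N(L⁺_v)`** (the invariance of the open-cell functional of the N1 lower bound under the right regular action).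
[cite: BernsteinZelevinsky1976, §1.7] [cite: Casselman1995, proof of Prop. 6.2.1] -/
theorem integral_mul_right_eq_self_cmBorelTriple_N [LocallyCompactSpace ↥(cmBorelTriple L N v).N]
    [SecondCountableTopology ↥(cmBorelTriple L N v).N] [MeasurableSpace ↥(cmBorelTriple L N v).N] [BorelSpace ↥(cmBorelTriple L N v).N]
    (ν : Measure ↥(cmBorelTriple L N v).N) [ν.IsHaarMeasure] {E : Type*} [NormedAddCommGroup E] [NormedSpace ℝ E]
    (f : ↥(cmBorelTriple L N v).N → E) (n₀ : ↥(cmBorelTriple L N v).N) :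
    ∫ n, f (n * n₀) ∂ν = ∫ n, f n ∂ν :=
  (isLimitOfCompactOpen_cmBorelTriple_N L N v).integral_mul_right_eq_self ν f n₀

end CM

end Literature.NumberTheory.Automorphic

end
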